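import Summits.BirchSwinnertonDyer.BirchSwinnertonDyer.Theorems.EdixhovenFibreFiveSevenStarredOptimalManinUnitFiveSevenReceptacleNoTorsion
import Summits.BirchSwinnertonDyer.BirchSwinnertonDyer.Theorems.EdixhovenFibreFiveSevenReceptacleTorsionElevenLe
import HarnessLib

/-!
# The Kim–Nakamura / Kosters–Pannekoek receptacle `log_ω(E₀(K)) = 𝒪_K` at EVERY additive prime `p ≥ 11`, over
# every UNRAMIFIED `K ⊇ ℚ_p`, with NO torsion hypothesis — F″'s branch `7 < p`

Route `EdixhovenFibreFiveSeven`, crux K★ `StarredOptimalManinUnitFiveSeven` (stmt-BirchSwinnertonDyer-22226),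
line `kato-lever`, seat `bsd-line-edix-p2` g4; `--supports` 22226 (helper toward the ONE open stub F″ =
`Literature.NumberTheory.EllipticCurves.kato_neron_isIntegral_twistedSymbolSum_of_additive_five_le`, programme piece
P2 of `Cruxes/StarredOptimalManinUnitFiveSeven/Lines/kato-lever-F2-programme.md`). TOOL theorems only (no definition,
no named fact, no `sorry`); nothing is closed or booked; BSD is not proved by any of this.

WHY. The receptacle `Λ̃ : E₀(K) ↠ 𝒪_K` (seat edix-p1 g5, `StarredOptimalManinUnitFiveSevenReceptacle.
exists_mem_nonsingularReductionSubgroup_satLog_eq`: any `M/ℤ_p` with cuspidal `𝒪_K`-model, `K/ℚ_p` finite unramified,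
`p` odd) carries ONE hypothesis, `E₀(K)[p] = 0`, discharged so far on the K★ slice `p ∈ {5,7}`, `4 ≤ v_pΔ_min`
(`…ReceptacleNoTorsion`, p597608). F″ is consumed at EVERY additive `p ≥ 5` (AKR crux #7 `ManinFrameResidueProperR`
through `maninFrameResidueProperR_of_kato`, TDS11 through `twistDegreeStepOrdinary_of_kato_five_le`), and in its branch
`7 < p` Kosters–Pannekoek's Thm. 1 has NO exceptional case. THIS file discharges the hypothesis there: the unit-abscissa
theorem at `p ≥ 11` over any ultrametric field (this seat's `ReceptacleTorsion.
eq_zero_of_prime_nsmul_eq_zero_of_mem_nonsingularReductionSubgroup_short`, p597493) transported from the short form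
`y² = x³ + Ax + B` (`A, B ∈ pℤ_p` at any additive `p ≥ 5`, tree `norm_lt_one_of_short`) to an ARBITRARY `ℤ_p`-model
with `‖Δ‖, ‖c₄‖ < 1` along Mathlib's `toShortNF` (`u = 1`, over `ℤ_p ⊂ 𝒪_K`; edix-p1 g5's transport pattern:
`hasNonsingularReduction_variableChange_some_iff` + `VariableChange.pointEquiv`), and then the five receptacle statements
of p596837 with the torsion hypothesis REMOVED at `p ≥ 11`, for any additive `M/ℤ_p` and for the minimal model
`W_ℤ ⊗ ℤ_p` of a globally minimal `W/ℚ` with `Addv W p`.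

* §1 `noPTorsion_of_additive_eleven_le` — `M/ℤ_p`, `‖Δ(M)‖, ‖c₄(M)‖ < 1`, `11 ≤ p`, `K` unramified: `E₀(K)[p] = 0`.
* §2 `noPTorsion_of_addv_eleven_le` — the minimal model of `W/ℚ` at an additive `p ≥ 11`.
* §3 ★ receptacle at `p ≥ 11`, any additive `M`: `exists_mem_nonsingularReductionSubgroup_satLog_eq_of_additive_eleven_le`
  (`Λ̃ : E₀(K) ↠ 𝒪_K`), `image_…_eq_…`, `satLog_eq_zero_iff_…`, `…padicLogPointFiniteExt…`,
  `norm_trace_mul_le_one_of_forall_point_of_additive_eleven_le` ((S5b) currency: `exp*_ω(H¹(K,T)) ⊆ 𝒪_K^∨`).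
* §4 the same for `W_ℤ ⊗ K`, `Addv W p`, `11 ≤ p` (`…_of_addv_eleven_le`).

References: [KostersPannekoek2017] M. Kosters, R. Pannekoek, arXiv:1703.07888, Thm. 1 (no exceptional case for
`p > 7`), Cor. 2; [KimNakamura2020] C.-H. Kim, K. Nakamura, J. Number Theory 210 (2020), Thm. 2.1, Cor. 2.3, Cor. 2.4,
Remark 1.8 (1); [Mazur1977] B. Mazur, Publ. Math. IHÉS 47 (1977), Ch. III §5 Step 1; [SilvermanAEC2009]
J. H. Silverman, *The Arithmetic of Elliptic Curves*, 2nd ed., III.1, VII.2.1–2.2, VII.3.1, IV.6.4, Exercise 3.7.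
-/

set_option autoImplicit false
-- the Theorems namespace of a single-conjunct summit repeats the summit name by design (D-0017)
set_option linter.dupNamespace false

noncomputable section

open scoped Classical NNReal
open WeierstrassCurve Literature.NumberTheory.EllipticCurves Literature.NumberTheory.EllipticCurves.FormalGroupChart
open Literature.NumberTheory.EllipticCurves.CuspJets
open Summit.BirchSwinnertonDyer.Rank1Residual.Additive
open Summit.BirchSwinnertonDyer.Rank1Residual.Additive.BallEval
open Summit.BirchSwinnertonDyer.BirchSwinnertonDyer.Theorems.KPort
open Summit.BirchSwinnertonDyer.BirchSwinnertonDyer.Theorems.StarredOptimalManinUnitFiveSevenReceptacle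
open Literature.NumberTheory.GaloisRepresentations.LubinTate (unitBall mem_unitBall_iff)

namespace Summit.BirchSwinnertonDyer.BirchSwinnertonDyer.Theorems.ReceptacleTorsion

variable {p : ℕ} [hp : Fact p.Prime] {K : Type*} [NontriviallyNormedField K] [NormedAlgebra ℚ_[p] K]
  [IsUltrametricDist K]

/-! ## §1 `E₀(K)[p] = 0` for ANY additive `ℤ_p`-model at `p ≥ 11` over an unramified `K` -/

section Transport

variable {M : WeierstrassCurve ℤ_[p]} [hE : (M.map PadicInt.Coe.ringHom).IsElliptic]

/-- **`E₀(K)[p] = 0` at an ADDITIVE prime `p ≥ 11` over every UNRAMIFIED ultrametric normed `ℚ_p`-field `K`**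
(`‖z‖ < 1 ⇒ ‖z‖ ≤ ‖p‖`), for EVERY `M/ℤ_p` with elliptic generic fibre and `‖Δ(M)‖, ‖c₄(M)‖ < 1` (cuspidal
`𝒪_K`-model; no minimality needed, no torsion or Kodaira hypothesis — Kosters–Pannekoek: no exceptional case for
`p > 7`): transport of this seat's short-model theorem (p597493) along `toShortNF` (`u = 1`, defined over `ℤ_p` since
`6 ∈ ℤ_pˣ`), exactly as edix-p1 g5's `noPTorsion_of_norm_c₄_c₆_le` at `p ∈ {5,7}`.
[cite: KostersPannekoek2017, Thm. 1] [cite: Mazur1977, Ch. III §5, Step 1, p. 158] [cite: SilvermanAEC2009, III.1 and VII.2 Prop. 2.1] -/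
theorem noPTorsion_of_additive_eleven_le (h11 : 11 ≤ p) (hK : ∀ z : K, ‖z‖ < 1 → ‖z‖ ≤ ‖(p : K)‖)
    (hΔ : ‖M.Δ‖ < 1) (hc₄ : ‖M.c₄‖ < 1)
    {P : (curveK p K M).toAffine.Point}
    (hP : P ∈ (M.map (coeffHom p K)).nonsingularReductionSubgroup
      (Valuation.integer.integers (NormedField.valuation (K := K))))
    (hpP : p • P = 0) : P = 0 := by
  have hp5 : 5 ≤ p := by omega
  obtain ⟨h2, h3⟩ := norm_two_three (p := p) hp5
  haveI : Invertible (2 : ℤ_[p]) := (PadicInt.isUnit_iff.mpr h2).invertible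
  haveI : Invertible (3 : ℤ_[p]) := (PadicInt.isUnit_iff.mpr h3).invertible
  set D : VariableChange ℤ_[p] := M.toShortNF with hD
  have hDu : D.u = 1 := toShortNF_u M
  haveI hNF : (D • M).IsShortNF := WeierstrassCurve.toShortNF_spec M
  set A := (D • M).a₄ with hA'
  set B := (D • M).a₆ with hB'
  have hM : D • M = shortCurve A B := WeierstrassCurve.ext hNF.a₁ hNF.a₂ hNF.a₃ rfl rfl
  -- `‖A‖, ‖B‖ < 1` from `‖c₄‖ < 1`, `‖Δ‖ < 1` (`u = 1`)
  have ec₄ : (shortCurve A B).c₄ = M.c₄ := by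
    rw [← hM, variableChange_c₄, hDu, inv_one, Units.val_one, one_pow, one_mul]
  have eΔ : (shortCurve A B).Δ = M.Δ := by
    rw [← hM, variableChange_Δ, hDu, inv_one, Units.val_one, one_pow, one_mul]
  obtain ⟨hA, hB⟩ := norm_lt_one_of_short (p := p) hp5 (by rw [ec₄]; exact hc₄) (by rw [eΔ]; exact hΔ)
  -- ellipticity and integrality of the short model
  haveI hE' : ((shortCurve A B).map PadicInt.Coe.ringHom).IsElliptic := by
    rw [← hM, ← map_variableChange]; infer_instance
  haveI : (curveK p K (shortCurve A B)).IsElliptic := isElliptic_curveK p K (shortCurve A B)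
  -- the change of variables over `K` and the induced isomorphism of point groups
  set f : ℤ_[p] →+* K := (unitBall K).subtype.comp (coeffHom p K) with hf
  have hcurve : (D.map f) • curveK p K M = curveK p K (shortCurve A B) := by
    rw [curveK, curveK, map_variableChange, hM]
  set e := VariableChange.pointEquiv (curveK p K M) (D.map f) with he
  rcases P with _ | ⟨x, y, h⟩
  · rfl
  · exfalso
    -- the transported point `Q = (x', y')` on the short model
    have h' : (curveK p K (shortCurve A B)).toAffine.Nonsingular ((D.map f).toX x) ((D.map f).toY x y) := by
      rw [← hcurve]; exact (VariableChange.nonsingular_iff _ _ x y).mpr h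
    have hQ : Affine.Point.congrEquiv hcurve (e (.some x y h)) = .some ((D.map f).toX x) ((D.map f).toY x y) h' := by
      rw [he, VariableChange.pointEquiv_some, Affine.Point.congrEquiv_some]
    -- `Q ∈ E₀(K)` of the short model
    have hV : (D.map (coeffHom p K)) • (M.map (coeffHom p K)) = (shortCurve A B).map (coeffHom p K) := by
      rw [map_variableChange, hM]
    have hfD : (D.map (coeffHom p K)).map (algebraMap (unitBall K) K) = D.map f := by
      rw [VariableChange.map_map]; rfl
    have hQ0 : ((shortCurve A B).map (coeffHom p K)).HasNonsingularReduction
        (Affine.Point.some ((D.map f).toX x) ((D.map f).toY x y) h') :=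
      (hasNonsingularReduction_variableChange_some_iff (Ω := K) (M.map (coeffHom p K))
        (D.map (coeffHom p K)) hV (by rw [hfD]) (by rw [hfD]) h h').mpr hP
    -- `p • Q = O`, hence `Q = O` by p597493 — contradiction
    have hpQ : p • (Affine.Point.some ((D.map f).toX x) ((D.map f).toY x y) h' :
        (curveK p K (shortCurve A B)).toAffine.Point) = 0 := by
      rw [← hQ, ← map_nsmul, ← map_nsmul, hpP, map_zero, map_zero]
    exact absurd (eq_zero_of_prime_nsmul_eq_zero_of_mem_nonsingularReductionSubgroup_short h11 hA hB hK hQ0 hpQ)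
      (Affine.Point.some_ne_zero h')

end Transport

/-! ## §2 The minimal model of `W/ℚ` at an additive `p ≥ 11` -/

section Rat

variable (W : WeierstrassCurve ℚ) [W.IsElliptic] [W.IsGloballyMinimal]

/-- **`E₀(K)[p] = 0` for the minimal model of `W/ℚ` over every UNRAMIFIED `K ⊇ ℚ_p` at an additive `p ≥ 11`** — no
Kodaira-type or torsion hypothesis (Kosters–Pannekoek: no exceptional case for `p > 7`).
[cite: KostersPannekoek2017, Thm. 1] [cite: KimNakamura2020, Thm. 2.1] -/
theorem noPTorsion_of_addv_eleven_le (h11 : 11 ≤ p) (hadd : Rank1Residual.Addv W p)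
    (hK : ∀ z : K, ‖z‖ < 1 → ‖z‖ ≤ ‖(p : K)‖)
    {P : (curveK p K ((integralModelInt W).map (Int.castRingHom ℤ_[p]))).toAffine.Point}
    (hP : P ∈ (((integralModelInt W).map (Int.castRingHom ℤ_[p])).map (coeffHom p K)).nonsingularReductionSubgroup
      (Valuation.integer.integers (NormedField.valuation (K := K))))
    (hpP : p • P = 0) : P = 0 := by
  haveI := isElliptic_map_integralModelInt_padic (p := p) W
  obtain ⟨hΔ, hc₄⟩ := norm_Δ_lt_one_of_addv (p := p) W hadd
  exact noPTorsion_of_additive_eleven_le h11 hK hΔ hc₄ hP hpP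

end Rat

/-! ## §3 ★ The receptacle at `p ≥ 11` for ANY additive `M/ℤ_p`: `Λ̃ : E₀(K) ↠ 𝒪_K`, no torsion hypothesis -/

section Receptacle

variable [CompleteSpace K] {M : WeierstrassCurve ℤ_[p]} [hE : (M.map PadicInt.Coe.ringHom).IsElliptic]
  [hint : (curveK p K M).IsIntegral (NormedField.valuation (K := K)).integer]

/-- ★ **THE RECEPTACLE AT `p ≥ 11`.** `M/ℤ_p` with `‖Δ‖, ‖c₄‖ < 1` (additive), `11 ≤ p`, `K/ℚ_p` finite UNRAMIFIED:
`Λ̃ : E₀(K) ↠ 𝒪_K` (every `y ∈ 𝒪_K` is `Λ̃ P` for some `P ∈ E₀(K)`) — Kim–Nakamura Thm. 2.1 / Cor. 2.3 = Kosters–Pannekoek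
Thm. 1 over `K`, unconditionally at `p > 7` (edix-p1 g5's p596837 with its torsion hypothesis discharged by §1).
[cite: KimNakamura2020, Thm. 2.1, Cor. 2.3, Cor. 2.4] [cite: KostersPannekoek2017, Thm. 1] -/
theorem exists_mem_nonsingularReductionSubgroup_satLog_eq_of_additive_eleven_le [FiniteDimensional ℚ_[p] K]
    (h11 : 11 ≤ p) (hK : ∀ z : K, ‖z‖ < 1 → ‖z‖ ≤ ‖(p : K)‖) (hΔ : ‖M.Δ‖ < 1) (hc₄ : ‖M.c₄‖ < 1)
    {y : K} (hy : ‖y‖ ≤ 1) :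
    ∃ P ∈ (M.map (coeffHom p K)).nonsingularReductionSubgroup
        (Valuation.integer.integers (NormedField.valuation (K := K))), satLog p K M P = y :=
  exists_mem_nonsingularReductionSubgroup_satLog_eq (by omega) hK hΔ hc₄
    (fun _ hP hpP => noPTorsion_of_additive_eleven_le h11 hK hΔ hc₄ hP hpP) hy

/-- `Λ̃(E₀(K)) = 𝒪_K` (same hypotheses). [cite: KimNakamura2020, Cor. 2.3] [cite: KostersPannekoek2017, Thm. 1] -/
theorem image_satLog_nonsingularReductionSubgroup_eq_of_additive_eleven_le [FiniteDimensional ℚ_[p] K]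
    (h11 : 11 ≤ p) (hK : ∀ z : K, ‖z‖ < 1 → ‖z‖ ≤ ‖(p : K)‖) (hΔ : ‖M.Δ‖ < 1) (hc₄ : ‖M.c₄‖ < 1) :
    satLog p K M '' {P : (curveK p K M).toAffine.Point |
        P ∈ (M.map (coeffHom p K)).nonsingularReductionSubgroup
          (Valuation.integer.integers (NormedField.valuation (K := K)))} =
      {y : K | ‖y‖ ≤ 1} :=
  image_satLog_nonsingularReductionSubgroup_eq (by omega) hK hΔ hc₄
    (fun _ hP hpP => noPTorsion_of_additive_eleven_le h11 hK hΔ hc₄ hP hpP)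

omit [CompleteSpace K] in
/-- `Λ̃` is injective on `E₀(K)` (same hypotheses): `Λ̃ P = 0 ↔ P = O`, so `Λ̃ : E₀(K) ⥲ 𝒪_K`.
[cite: KostersPannekoek2017, Thm. 1] [cite: SilvermanAEC2009, VII.2 Prop. 2.1 and Thm. IV.6.4] -/
theorem satLog_eq_zero_iff_of_additive_eleven_le [CompleteSpace K] (h11 : 11 ≤ p)
    (hK : ∀ z : K, ‖z‖ < 1 → ‖z‖ ≤ ‖(p : K)‖) (hΔ : ‖M.Δ‖ < 1) (hc₄ : ‖M.c₄‖ < 1)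
    {P : (curveK p K M).toAffine.Point}
    (hP : P ∈ (M.map (coeffHom p K)).nonsingularReductionSubgroup
      (Valuation.integer.integers (NormedField.valuation (K := K)))) :
    satLog p K M P = 0 ↔ P = 0 :=
  satLog_eq_zero_iff_of_mem_nonsingularReductionSubgroup (by omega) hK hΔ hc₄
    (fun _ hP hpP => noPTorsion_of_additive_eleven_le h11 hK hΔ hc₄ hP hpP) hP

/-- (S5b) currency: every `y ∈ 𝒪_K` is `log_ω(P) = FormalGroupChart.padicLogPointFiniteExt ‖·‖ E p P` for some
`P ∈ E₀(K)` (same hypotheses). [cite: KimNakamura2020, Cor. 2.4] [cite: SilvermanAEC2009, Thm. IV.6.4 with Prop. VII.2.2] -/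
theorem exists_mem_nonsingularReductionSubgroup_padicLogPointFiniteExt_eq_of_additive_eleven_le
    [FiniteDimensional ℚ_[p] K] (h11 : 11 ≤ p) (hK : ∀ z : K, ‖z‖ < 1 → ‖z‖ ≤ ‖(p : K)‖)
    (hΔ : ‖M.Δ‖ < 1) (hc₄ : ‖M.c₄‖ < 1) {y : K} (hy : ‖y‖ ≤ 1) :
    ∃ P ∈ (M.map (coeffHom p K)).nonsingularReductionSubgroup
        (Valuation.integer.integers (NormedField.valuation (K := K))),
      padicLogPointFiniteExt (NormedField.valuation (K := K)) (curveK p K M) p P = y :=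
  exists_mem_nonsingularReductionSubgroup_padicLogPointFiniteExt_eq (by omega) hK hΔ hc₄
    (fun _ hP hpP => noPTorsion_of_additive_eleven_le h11 hK hΔ hc₄ hP hpP) hy

/-- ★ **The trace form consumed with (S5b)** at `p ≥ 11`, no torsion hypothesis: if `‖Tr_{K/ℚ_p}(a · log_ω P)‖ ≤ 1`
for every `P ∈ E(K)` (the RHS of `PAdicHodge.exists_smul_range_expStarCoord_iff_trace_log` for `M ⊗ K`:
`a ∈ exp*_ω(H¹(K, T_pE))`), then `‖Tr_{K/ℚ_p}(a · o)‖ ≤ 1` for every `o ∈ 𝒪_K` — `exp*_ω(H¹(K_v, T_pE)) ⊆ 𝒪_v^∨ = 𝒪_v`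
(trace dual of an unramified extension, seat edix-p5's `…TraceDual`), i.e. Kim–Nakamura Cor. 2.4 over the unramified
completions at every additive `p ≥ 11`. [cite: KimNakamura2020, Cor. 2.4] [cite: KostersPannekoek2017, Thm. 1] -/
theorem norm_trace_mul_le_one_of_forall_point_of_additive_eleven_le [FiniteDimensional ℚ_[p] K]
    (h11 : 11 ≤ p) (hK : ∀ z : K, ‖z‖ < 1 → ‖z‖ ≤ ‖(p : K)‖) (hΔ : ‖M.Δ‖ < 1) (hc₄ : ‖M.c₄‖ < 1) {a : K}
    (ha : ∀ P : (curveK p K M).toAffine.Point,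
      ‖Algebra.trace ℚ_[p] K (a * padicLogPointFiniteExt (NormedField.valuation (K := K)) (curveK p K M) p P)‖ ≤ 1)
    {o : K} (ho : ‖o‖ ≤ 1) : ‖Algebra.trace ℚ_[p] K (a * o)‖ ≤ 1 :=
  norm_trace_mul_le_one_of_forall_point (by omega) hK hΔ hc₄
    (fun _ hP hpP => noPTorsion_of_additive_eleven_le h11 hK hΔ hc₄ hP hpP) ha ho

end Receptacle

/-! ## §4 ★ The receptacle for the MINIMAL MODEL of `W/ℚ` at every additive `p ≥ 11` -/

section RatReceptacle

variable [CompleteSpace K] (W : WeierstrassCurve ℚ) [W.IsElliptic] [W.IsGloballyMinimal]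
  [(curveK p K ((integralModelInt W).map (Int.castRingHom ℤ_[p]))).IsIntegral
    (NormedField.valuation (K := K)).integer]

/-- ★ **`Λ̃ : E₀(K) ↠ 𝒪_K` for the minimal model `W_ℤ ⊗ K` of a globally minimal `W/ℚ` at an additive `p ≥ 11`, `K/ℚ_p`
finite UNRAMIFIED** — the receptacle of F″'s branch `7 < p` as a theorem. [cite: KimNakamura2020, Thm. 2.1, Cor. 2.3]
[cite: KostersPannekoek2017, Thm. 1] -/
theorem exists_mem_nonsingularReductionSubgroup_satLog_eq_of_addv_eleven_le [FiniteDimensional ℚ_[p] K]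
    (h11 : 11 ≤ p) (hadd : Rank1Residual.Addv W p) (hK : ∀ z : K, ‖z‖ < 1 → ‖z‖ ≤ ‖(p : K)‖)
    {y : K} (hy : ‖y‖ ≤ 1) :
    ∃ P ∈ (((integralModelInt W).map (Int.castRingHom ℤ_[p])).map (coeffHom p K)).nonsingularReductionSubgroup
        (Valuation.integer.integers (NormedField.valuation (K := K))),
      satLog p K ((integralModelInt W).map (Int.castRingHom ℤ_[p])) P = y := by
  haveI := isElliptic_map_integralModelInt_padic (p := p) W
  obtain ⟨hΔ, hc₄⟩ := norm_Δ_lt_one_of_addv (p := p) W hadd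
  exact exists_mem_nonsingularReductionSubgroup_satLog_eq_of_additive_eleven_le h11 hK hΔ hc₄ hy

/-- `Λ̃(E₀(K)) = 𝒪_K` for `W_ℤ ⊗ K` (same hypotheses). [cite: KimNakamura2020, Cor. 2.3] -/
theorem image_satLog_nonsingularReductionSubgroup_eq_of_addv_eleven_le [FiniteDimensional ℚ_[p] K]
    (h11 : 11 ≤ p) (hadd : Rank1Residual.Addv W p) (hK : ∀ z : K, ‖z‖ < 1 → ‖z‖ ≤ ‖(p : K)‖) :
    satLog p K ((integralModelInt W).map (Int.castRingHom ℤ_[p])) ''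
        {P : (curveK p K ((integralModelInt W).map (Int.castRingHom ℤ_[p]))).toAffine.Point |
          P ∈ (((integralModelInt W).map (Int.castRingHom ℤ_[p])).map (coeffHom p K)).nonsingularReductionSubgroup
            (Valuation.integer.integers (NormedField.valuation (K := K)))} =
      {y : K | ‖y‖ ≤ 1} := by
  haveI := isElliptic_map_integralModelInt_padic (p := p) W
  obtain ⟨hΔ, hc₄⟩ := norm_Δ_lt_one_of_addv (p := p) W hadd
  exact image_satLog_nonsingularReductionSubgroup_eq_of_additive_eleven_le h11 hK hΔ hc₄

/-- `Λ̃ P = 0 ↔ P = O` on `E₀(K)` of `W_ℤ ⊗ K` (same hypotheses). [cite: SilvermanAEC2009, VII.2 Prop. 2.1 and Thm. IV.6.4] -/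
theorem satLog_eq_zero_iff_of_addv_eleven_le (h11 : 11 ≤ p) (hadd : Rank1Residual.Addv W p)
    (hK : ∀ z : K, ‖z‖ < 1 → ‖z‖ ≤ ‖(p : K)‖)
    {P : (curveK p K ((integralModelInt W).map (Int.castRingHom ℤ_[p]))).toAffine.Point}
    (hP : P ∈ (((integralModelInt W).map (Int.castRingHom ℤ_[p])).map (coeffHom p K)).nonsingularReductionSubgroup
      (Valuation.integer.integers (NormedField.valuation (K := K)))) :
    satLog p K ((integralModelInt W).map (Int.castRingHom ℤ_[p])) P = 0 ↔ P = 0 := by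
  haveI := isElliptic_map_integralModelInt_padic (p := p) W
  obtain ⟨hΔ, hc₄⟩ := norm_Δ_lt_one_of_addv (p := p) W hadd
  exact satLog_eq_zero_iff_of_additive_eleven_le h11 hK hΔ hc₄ hP

/-- (S5b) currency for `W_ℤ ⊗ K`: every `y ∈ 𝒪_K` is `padicLogPointFiniteExt ‖·‖ E p P` for some `P ∈ E₀(K)`
(same hypotheses). [cite: KimNakamura2020, Cor. 2.4] -/
theorem exists_mem_nonsingularReductionSubgroup_padicLogPointFiniteExt_eq_of_addv_eleven_le
    [FiniteDimensional ℚ_[p] K] (h11 : 11 ≤ p) (hadd : Rank1Residual.Addv W p)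
    (hK : ∀ z : K, ‖z‖ < 1 → ‖z‖ ≤ ‖(p : K)‖) {y : K} (hy : ‖y‖ ≤ 1) :
    ∃ P ∈ (((integralModelInt W).map (Int.castRingHom ℤ_[p])).map (coeffHom p K)).nonsingularReductionSubgroup
        (Valuation.integer.integers (NormedField.valuation (K := K))),
      padicLogPointFiniteExt (NormedField.valuation (K := K))
        (curveK p K ((integralModelInt W).map (Int.castRingHom ℤ_[p]))) p P = y := by
  haveI := isElliptic_map_integralModelInt_padic (p := p) W
  obtain ⟨hΔ, hc₄⟩ := norm_Δ_lt_one_of_addv (p := p) W hadd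
  exact exists_mem_nonsingularReductionSubgroup_padicLogPointFiniteExt_eq_of_additive_eleven_le h11 hK hΔ hc₄ hy

/-- ★ **The trace form consumed with (S5b) for `W_ℤ ⊗ K` at an additive `p ≥ 11`**, `K/ℚ_p` finite unramified:
`‖Tr(a · log_ω P)‖ ≤ 1` for all `P ∈ E(K)` ⟹ `‖Tr(a · o)‖ ≤ 1` for all `o ∈ 𝒪_K`. [cite: KimNakamura2020, Cor. 2.4] -/
theorem norm_trace_mul_le_one_of_forall_point_of_addv_eleven_le [FiniteDimensional ℚ_[p] K]
    (h11 : 11 ≤ p) (hadd : Rank1Residual.Addv W p) (hK : ∀ z : K, ‖z‖ < 1 → ‖z‖ ≤ ‖(p : K)‖) {a : K}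
    (ha : ∀ P : (curveK p K ((integralModelInt W).map (Int.castRingHom ℤ_[p]))).toAffine.Point,
      ‖Algebra.trace ℚ_[p] K (a * padicLogPointFiniteExt (NormedField.valuation (K := K))
        (curveK p K ((integralModelInt W).map (Int.castRingHom ℤ_[p]))) p P)‖ ≤ 1)
    {o : K} (ho : ‖o‖ ≤ 1) : ‖Algebra.trace ℚ_[p] K (a * o)‖ ≤ 1 := by
  haveI := isElliptic_map_integralModelInt_padic (p := p) W
  obtain ⟨hΔ, hc₄⟩ := norm_Δ_lt_one_of_addv (p := p) W hadd
  exact norm_trace_mul_le_one_of_forall_point_of_additive_eleven_le h11 hK hΔ hc₄ ha ho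

end RatReceptacle

end Summit.BirchSwinnertonDyer.BirchSwinnertonDyer.Theorems.ReceptacleTorsion

end
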